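import Summits.RiemannHypothesis.RiemannHypothesis.Theorems.GroundBartaEvenWinsBeyondArchDeflationCrossPanelsFour
import HarnessLib

/-!
# RiemannHypothesis / GroundBarta — rung 4 (`EvenWinsBeyondArch`, stmt-RiemannHypothesis-18807 / 18085):
# R-layer cross products from per-panel SUP RADII (lever #7 of prover B: the cross Gram without re-assembled panel models)

Helper file (`--supports stmt-RiemannHypothesis-18085`), RH-free, no facts, standard axioms.

The per-panel two-sided cross bounds of `…DeflationCrossPanelsFour` (`dt_panelCross4_bulk''`,
`dt_panelCross4_split''`) conclude with `crossErrQ S h T_i p_i T_{i'} p_{i'} a b w`, where `T_i`, `T_{i'}` are the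
degree-`Dl` panel Taylor models of the two residuals (`dt_panelLTM4' …`, re-assembled by the kernel inside every cross
decide: ≈ 6 s each at `Dl = 32`, `S = 2^160`, twice per panel and pair).  But `crossErrQ` sees the models ONLY through
the two sup radii `δ_i = tabsI S h (T_i − p_i)/S`, and it is MONOTONE in them.  This file names the radius
(`dt_tmRadQ`), the radius form of the error (`dt_crossErrRadQ`, pure small-rational arithmetic in `p_i`, `p_{i'}` and two
numbers), proves the monotonicity (`dt_crossErrQ_le_rad`) and restates the bulk / split panel cross bounds with radius
HYPOTHESES `dt_tmRadQ S h T_i p_i ≤ d_i` (`dt_panelCross4_bulk_rad`, `dt_panelCross4_split_rad`).  A certificate then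
proves `d_i` ONCE per (vector, panel, flag set) next to the panel's `L²` bound (one more cheap-to-state decide in the
Q file, where the model is assembled anyway) and every cross decide becomes `lo ≤ centre − dt_crossErrRadQ … ∧ … ≤ hi`
(milliseconds): the cross layer of a cell is bounded by file LINES, not kernel time (≈ 120 → ≈ 40 gate files per cell),
and all `k(k−1)/2` pairs become affordable (better-conditioned final `LDLᵀ` certificate).

References: E. Bombieri, Rend. Mat. Acc. Lincei (9) 11 (2000) Thm 2 [Bombieri2000Weil]; R. E. Moore, *Interval Analysis*
(1966) Thm 3.1 [Moore1966]; Goerisch–Haunhorst (1985) §2 [GoerischHaunhorst1985].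
-/

set_option linter.dupNamespace false

noncomputable section

open MeasureTheory Set Filter intervalIntegral
open scoped Topology BigOperators ComplexConjugate

namespace Summit.RiemannHypothesis.RiemannHypothesis.Theorems.EvenWinsBeyondArch

open Literature.NumberTheory.LFunctions
open Literature.Analysis.ValidatedNumerics Literature.Analysis.ValidatedNumerics.PolyMP
  Literature.Analysis.ValidatedNumerics.NumericsMP Literature.Analysis.ValidatedNumerics.ExpPoly

section RadLemmas

/-- The sup radius `δ = tabsI S h (P − p)/S` of a Taylor model `P` (scale `S`, panel `|ρ| ≤ h`) around a rational
reference polynomial `p`: `|f − p| ≤ δ` on the panel whenever `TMem S h f P`. -/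
def dt_tmRadQ (S : ℕ) (h : ℚ) (P : IPoly) (p : Poly) : ℚ :=
  (tabsI S h (tsubI P (ratPolyI S p)) : ℚ) / S

/-- The radius form of `crossErrQ`: `(b − a)(‖p‖ d_q + ‖q‖ d_p + d_p d_q) + w ‖p‖ ‖q‖` with the sup norms
`‖p‖ = absBoundQ (shift p ((a+b)/2)) ((b−a)/2)` over `[a, b]` and two NUMBERS `d_p`, `d_q` in place of the models. -/
def dt_crossErrRadQ (dp dq : ℚ) (p q : Poly) (a b w : ℚ) : ℚ :=
  (b - a) * (absBoundQ (Poly.shift p ((a + b) / 2)) ((b - a) / 2) * dq +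
      absBoundQ (Poly.shift q ((a + b) / 2)) ((b - a) / 2) * dp + dp * dq) +
    w * (absBoundQ (Poly.shift p ((a + b) / 2)) ((b - a) / 2) * absBoundQ (Poly.shift q ((a + b) / 2)) ((b - a) / 2))

/-- `crossErrQ` is `dt_crossErrRadQ` at the true radii (definitional bookkeeping). -/
theorem dt_crossErrQ_eq_rad (S : ℕ) (h : ℚ) (P Q : IPoly) (p q : Poly) (a b w : ℚ) :
    crossErrQ S h P p Q q a b w = dt_crossErrRadQ (dt_tmRadQ S h P p) (dt_tmRadQ S h Q q) p q a b w := by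
  simp only [crossErrQ, dt_crossErrRadQ, dt_tmRadQ]

/-- `absBoundQ p h ≥ 0` for `h ≥ 0` (a sum of `|c| hⁿ`). -/
theorem dt_absBoundQ_nonneg {h : ℚ} (hh : 0 ≤ h) : ∀ p : Poly, 0 ≤ absBoundQ p h
  | [] => by simp [absBoundQ]
  | c :: p => by
      have := dt_absBoundQ_nonneg hh p
      simp only [absBoundQ]
      positivity

/-- A Taylor model that encloses some function has a nonnegative radius around any reference polynomial. -/
theorem dt_tmRadQ_nonneg_of_tmem {S : ℕ} (hS : 0 < S) {h : ℚ} (h0 : 0 ≤ h) {f : ℝ → ℝ} {P : IPoly}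
    (hf : TMem S h f P) (p : Poly) : 0 ≤ dt_tmRadQ S h P p := by
  have h1 := abs_sub_poly_le_of_tmem hS h0 hf p (ρ := 0) (by rw [abs_zero]; exact_mod_cast h0)
  have h2 : (0 : ℝ) ≤ (tabsI S h (tsubI P (ratPolyI S p)) : ℝ) / S := (abs_nonneg _).trans h1
  have e : ((dt_tmRadQ S h P p : ℚ) : ℝ) = (tabsI S h (tsubI P (ratPolyI S p)) : ℝ) / S := by
    simp only [dt_tmRadQ]; push_cast; rfl
  exact_mod_cast (e ▸ h2 : (0 : ℝ) ≤ ((dt_tmRadQ S h P p : ℚ) : ℝ))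

/-- **Monotonicity of the cross error in the radii.**  For `a ≤ b` and nonnegative true radii bounded by
`dp`, `dq`: `crossErrQ S h P p Q q a b w ≤ dt_crossErrRadQ dp dq p q a b w`. [cite: Moore1966, Theorem 3.1] -/
theorem dt_crossErrQ_le_rad {S : ℕ} {h : ℚ} {P Q : IPoly} {p q : Poly} {a b w dp dq : ℚ}
    (hab : a ≤ b) (hp0 : 0 ≤ dt_tmRadQ S h P p) (hq0 : 0 ≤ dt_tmRadQ S h Q q)
    (hp : dt_tmRadQ S h P p ≤ dp) (hq : dt_tmRadQ S h Q q ≤ dq) :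
    crossErrQ S h P p Q q a b w ≤ dt_crossErrRadQ dp dq p q a b w := by
  rw [dt_crossErrQ_eq_rad]
  set x := dt_tmRadQ S h P p with hx
  set y := dt_tmRadQ S h Q q with hy
  have hr : 0 ≤ (b - a) / 2 := by linarith
  have hAp := dt_absBoundQ_nonneg hr (Poly.shift p ((a + b) / 2))
  have hAq := dt_absBoundQ_nonneg hr (Poly.shift q ((a + b) / 2))
  set Ap := absBoundQ (Poly.shift p ((a + b) / 2)) ((b - a) / 2) with hApd
  set Aq := absBoundQ (Poly.shift q ((a + b) / 2)) ((b - a) / 2) with hAqd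
  simp only [dt_crossErrRadQ]
  have hba : 0 ≤ b - a := by linarith
  have h1 : Ap * y + Aq * x + x * y ≤ Ap * dq + Aq * dp + dp * dq :=
    add_le_add (add_le_add (mul_le_mul_of_nonneg_left hq hAp) (mul_le_mul_of_nonneg_left hp hAq))
      (mul_le_mul hp hq hq0 (hp0.trans hp))
  have h2 := mul_le_mul_of_nonneg_left h1 hba
  linarith

end RadLemmas

section CrossPanelsRad

variable {S : ℕ} {c : ℚ} {m Dl k : ℕ}

/-- Every chunked panel model encloses the panel form of its residual, so its radius around any reference polynomial
is nonnegative (no flag validity needed). -/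
theorem dt_tmRadQ_panelLTM4'_nonneg (hS : 0 < S) (hc : 0 < c) (W : dt_WinL4 S c m Dl) (hh1 : 2 * (c / (2 * m)) ≤ 1)
    (gp : Fin k → Poly) (Mt : ℚ) (Wt : Fin k → Fin k → ℚ) (i : Fin k) (V : dt_VecL S c m Dl (gp i)) {j : ℕ}
    (hjm : j + 2 ≤ m) {K : ℕ} (hK : 0 < K) {Ke ke : ℕ} (f1 f2 f3 f4 : Bool × Bool)
    (he1 : (MI.expPt S Ke ke (ofRat S (PolyMP.panelCentre (c / (2 * m)) j / 2))).isSome = true)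
    (he2 : (MI.expPt S Ke ke (ofRat S (-(PolyMP.panelCentre (c / (2 * m)) j / 2)))).isSome = true)
    (hlenM : (gp i).length ≤ W.M0.length + 1)
    {Etm F N R : IPoly}
    (hE : dt_archETM S c m j Dl (dt_locI S (gp i) (ofRat S (PolyMP.panelCentre (c / (2 * m)) j))) W.M0 (ttruncI S (c / (2 * m)) Dl (dt_locI S (gp i) (ofRat S (PolyMP.panelCentre (c / (2 * m)) j)))) V.tabF W.muF (fun i ↦ (W.Dρ.getD i default).1) (fun i ↦ (W.Dρ.getD i default).2) = Etm)
    (hF : dt_archHfoldTM S m j (ttruncI S (c / (2 * m)) Dl (dt_locI S (gp i) (ofRat S (PolyMP.panelCentre (c / (2 * m)) j)))) V.tabF W.muF = F) (hN : dt_archHnearTM S c m j Dl (ttruncI S (c / (2 * m)) Dl (dt_locI S (gp i) (ofRat S (PolyMP.panelCentre (c / (2 * m)) j)))) V.tabF W.muF (fun i ↦ (W.Dρ.getD i default).1) (fun i ↦ (W.Dρ.getD i default).2) = N)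
    (hR : dt_archHfarTM S c m j Dl (ttruncI S (c / (2 * m)) Dl (dt_locI S (gp i) (ofRat S (PolyMP.panelCentre (c / (2 * m)) j)))) V.tabF W.muF (fun i ↦ (W.Dρ.getD i default).1) (fun i ↦ (W.Dρ.getD i default).2) = R)
    (p : Poly) :
    0 ≤ dt_tmRadQ S (c / (2 * m)) (dt_panelLTM4' S c m Dl K Ke ke W gp Mt Wt i V j f1 f2 f3 f4 Etm (taddI (tsubI F N) R)) p := by
  have hm : 0 < m := by omega
  have hh0 : 0 ≤ c / (2 * m) := by
    have : (0 : ℚ) < m := by exact_mod_cast hm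
    positivity
  subst hE; subst hF; subst hN; subst hR
  rw [← dt_archHTM_split, dt_panelLTM4'_eq]
  exact dt_tmRadQ_nonneg_of_tmem hS hh0 (dt_tmem_panelLTM4 hS hc W hh1 gp Mt Wt i V hjm hK f1 f2 f3 f4 he1 he2 hlenM) p

/-- **Cross product on a bulk panel, two-sided, RADIUS form.**  As `dt_panelCross4_bulk''`, but the error is
`dt_crossErrRadQ d d' p p' (−h) h 0` for any certified radius bounds `d ≥ δ_i`, `d' ≥ δ_{i'}` of the two chunked
panel models around `p`, `p'` (hypotheses `hd`, `hd'`, each ONE decide in the vector's panel file).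
[cite: Bombieri2000Weil, Thm 2] [cite: Moore1966, Theorem 3.1] -/
theorem dt_panelCross4_bulk_rad (hS : 0 < S) (hc : 0 < c) (W : dt_WinL4 S c m Dl) (hh1 : 2 * (c / (2 * m)) ≤ 1)
    (gp : Fin k → Poly) (Mt : ℚ) (Wt : Fin k → Fin k → ℚ) (i i' : Fin k) (V : dt_VecL S c m Dl (gp i))
    (V' : dt_VecL S c m Dl (gp i')) {j : ℕ}
    (hjm : j + 2 ≤ m) {K : ℕ} (hK : 0 < K) {Ke ke : ℕ} {f1 f2 f3 f4 : Bool × Bool}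
    (hchk : dt_bulkCheckL4 S c m Dl W (gp i) j Ke ke f1 f2 f3 f4 = true)
    (hchk' : dt_bulkCheckL4 S c m Dl W (gp i') j Ke ke f1 f2 f3 f4 = true)
    {Etm F N R : IPoly}
    (hE : dt_archETM S c m j Dl (dt_locI S (gp i) (ofRat S (PolyMP.panelCentre (c / (2 * m)) j))) W.M0 (ttruncI S (c / (2 * m)) Dl (dt_locI S (gp i) (ofRat S (PolyMP.panelCentre (c / (2 * m)) j)))) V.tabF W.muF (fun i ↦ (W.Dρ.getD i default).1) (fun i ↦ (W.Dρ.getD i default).2) = Etm)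
    (hF : dt_archHfoldTM S m j (ttruncI S (c / (2 * m)) Dl (dt_locI S (gp i) (ofRat S (PolyMP.panelCentre (c / (2 * m)) j)))) V.tabF W.muF = F) (hN : dt_archHnearTM S c m j Dl (ttruncI S (c / (2 * m)) Dl (dt_locI S (gp i) (ofRat S (PolyMP.panelCentre (c / (2 * m)) j)))) V.tabF W.muF (fun i ↦ (W.Dρ.getD i default).1) (fun i ↦ (W.Dρ.getD i default).2) = N)
    (hR : dt_archHfarTM S c m j Dl (ttruncI S (c / (2 * m)) Dl (dt_locI S (gp i) (ofRat S (PolyMP.panelCentre (c / (2 * m)) j)))) V.tabF W.muF (fun i ↦ (W.Dρ.getD i default).1) (fun i ↦ (W.Dρ.getD i default).2) = R)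
    {Etm' F' N' R' : IPoly}
    (hE' : dt_archETM S c m j Dl (dt_locI S (gp i') (ofRat S (PolyMP.panelCentre (c / (2 * m)) j))) W.M0 (ttruncI S (c / (2 * m)) Dl (dt_locI S (gp i') (ofRat S (PolyMP.panelCentre (c / (2 * m)) j)))) V'.tabF W.muF (fun i ↦ (W.Dρ.getD i default).1) (fun i ↦ (W.Dρ.getD i default).2) = Etm')
    (hF' : dt_archHfoldTM S m j (ttruncI S (c / (2 * m)) Dl (dt_locI S (gp i') (ofRat S (PolyMP.panelCentre (c / (2 * m)) j)))) V'.tabF W.muF = F') (hN' : dt_archHnearTM S c m j Dl (ttruncI S (c / (2 * m)) Dl (dt_locI S (gp i') (ofRat S (PolyMP.panelCentre (c / (2 * m)) j)))) V'.tabF W.muF (fun i ↦ (W.Dρ.getD i default).1) (fun i ↦ (W.Dρ.getD i default).2) = N')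
    (hR' : dt_archHfarTM S c m j Dl (ttruncI S (c / (2 * m)) Dl (dt_locI S (gp i') (ofRat S (PolyMP.panelCentre (c / (2 * m)) j)))) V'.tabF W.muF (fun i ↦ (W.Dρ.getD i default).1) (fun i ↦ (W.Dρ.getD i default).2) = R')
    (hfg : IntervalIntegrable (fun ρ ↦
      dt_windowResidual4 (c : ℝ) gp W.w1 W.L1 W.w2 W.L2 W.w3 W.L3 W.w4 W.L4 (Mt : ℝ) (fun a l ↦ (Wt a l : ℝ)) i
        (((PolyMP.panelCentre (c / (2 * m)) j : ℚ) : ℝ) + ρ) *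
      dt_windowResidual4 (c : ℝ) gp W.w1 W.L1 W.w2 W.L2 W.w3 W.L3 W.w4 W.L4 (Mt : ℝ) (fun a l ↦ (Wt a l : ℝ)) i'
        (((PolyMP.panelCentre (c / (2 * m)) j : ℚ) : ℝ) + ρ)) volume (-((c / (2 * m) : ℚ) : ℝ)) ((c / (2 * m) : ℚ) : ℝ))
    (p p' : Poly) {d d' : ℚ}
    (hd : dt_tmRadQ S (c / (2 * m)) (dt_panelLTM4' S c m Dl K Ke ke W gp Mt Wt i V j f1 f2 f3 f4 Etm (taddI (tsubI F N) R)) p ≤ d)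
    (hd' : dt_tmRadQ S (c / (2 * m)) (dt_panelLTM4' S c m Dl K Ke ke W gp Mt Wt i' V' j f1 f2 f3 f4 Etm' (taddI (tsubI F' N') R')) p' ≤ d') :
    |(∫ ρ in (-((c / (2 * m) : ℚ) : ℝ))..((c / (2 * m) : ℚ) : ℝ),
        dt_windowResidual4 (c : ℝ) gp W.w1 W.L1 W.w2 W.L2 W.w3 W.L3 W.w4 W.L4 (Mt : ℝ) (fun a l ↦ (Wt a l : ℝ)) i
        (((PolyMP.panelCentre (c / (2 * m)) j : ℚ) : ℝ) + ρ) *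
        dt_windowResidual4 (c : ℝ) gp W.w1 W.L1 W.w2 W.L2 W.w3 W.L3 W.w4 W.L4 (Mt : ℝ) (fun a l ↦ (Wt a l : ℝ)) i'
        (((PolyMP.panelCentre (c / (2 * m)) j : ℚ) : ℝ) + ρ)) -
        ((crossCentreQ p p' (-(c / (2 * m))) (c / (2 * m)) : ℚ) : ℝ)| ≤
      ((dt_crossErrRadQ d d' p p' (-(c / (2 * m))) (c / (2 * m)) 0 : ℚ) : ℝ) := by
  have hm : 0 < m := by omega
  have hh0 : 0 ≤ c / (2 * m) := by
    have : (0 : ℚ) < m := by exact_mod_cast hm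
    positivity
  have h1 := dt_panelCross4_bulk'' hS hc W hh1 gp Mt Wt i i' V V' hjm hK hchk hchk' hE hF hN hR hE' hF' hN' hR' hfg p p'
  have hA := dt_tmemW4_bulk'' hS hc W hh1 gp Mt Wt i V hjm hK hchk hE hF hN hR
  have hB := dt_tmemW4_bulk'' hS hc W hh1 gp Mt Wt i' V' hjm hK hchk' hE' hF' hN' hR'
  have h2 := dt_crossErrQ_le_rad (a := -(c / (2 * m))) (b := c / (2 * m)) (w := 0) (by linarith)
    (dt_tmRadQ_nonneg_of_tmem hS hh0 hA p) (dt_tmRadQ_nonneg_of_tmem hS hh0 hB p') hd hd'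
  exact h1.trans ((Rat.cast_le (K := ℝ)).2 h2)

/-- **Cross product on a split panel, two-sided, RADIUS form** (breakpoint `β ∈ [b⁻, b⁺]`, flags `f` on `(-h, β)`,
`f'` on `(β, h)`; four radius bounds: `dA ≥ δ(T_i^f, pA)`, `dA' ≥ δ(T_{i'}^f, pA')`, `dB ≥ δ(T_i^{f'}, pB)`,
`dB' ≥ δ(T_{i'}^{f'}, pB')`). [cite: Bombieri2000Weil, Thm 2] [cite: Moore1966, Theorem 3.1] -/
theorem dt_panelCross4_split_rad (hS : 0 < S) (hc : 0 < c) (W : dt_WinL4 S c m Dl) (hh1 : 2 * (c / (2 * m)) ≤ 1)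
    (gp : Fin k → Poly) (Mt : ℚ) (Wt : Fin k → Fin k → ℚ) (i i' : Fin k) (V : dt_VecL S c m Dl (gp i))
    (V' : dt_VecL S c m Dl (gp i')) {j : ℕ}
    (hjm : j + 2 ≤ m) {K : ℕ} (hK : 0 < K) {Ke ke : ℕ} (f1 f2 f3 f4 f1' f2' f3' f4' : Bool × Bool) {β : ℝ} {bm bp : ℚ}
    (hchk : dt_splitCheckL S c m W.M0.length (gp i) j Ke ke bm bp = true)
    (hchk' : dt_splitCheckL S c m W.M0.length (gp i') j Ke ke bm bp = true) (hbmβ : (bm : ℝ) ≤ β) (hβbp : β ≤ bp)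
    (hflA : ∀ ρ : ℝ, -((c / (2 * m) : ℚ) : ℝ) < ρ → ρ < β →
      (f1.1 = true ↔ (((PolyMP.panelCentre (c / (2 * m)) j : ℚ) : ℝ) + ρ) - W.L1 ∈ Icc (-(c : ℝ)) c) ∧
      (f1.2 = true ↔ (((PolyMP.panelCentre (c / (2 * m)) j : ℚ) : ℝ) + ρ) + W.L1 ∈ Icc (-(c : ℝ)) c) ∧
      (f2.1 = true ↔ (((PolyMP.panelCentre (c / (2 * m)) j : ℚ) : ℝ) + ρ) - W.L2 ∈ Icc (-(c : ℝ)) c) ∧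
      (f2.2 = true ↔ (((PolyMP.panelCentre (c / (2 * m)) j : ℚ) : ℝ) + ρ) + W.L2 ∈ Icc (-(c : ℝ)) c) ∧
      (f3.1 = true ↔ (((PolyMP.panelCentre (c / (2 * m)) j : ℚ) : ℝ) + ρ) - W.L3 ∈ Icc (-(c : ℝ)) c) ∧
      (f3.2 = true ↔ (((PolyMP.panelCentre (c / (2 * m)) j : ℚ) : ℝ) + ρ) + W.L3 ∈ Icc (-(c : ℝ)) c) ∧
      (f4.1 = true ↔ (((PolyMP.panelCentre (c / (2 * m)) j : ℚ) : ℝ) + ρ) - W.L4 ∈ Icc (-(c : ℝ)) c) ∧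
      (f4.2 = true ↔ (((PolyMP.panelCentre (c / (2 * m)) j : ℚ) : ℝ) + ρ) + W.L4 ∈ Icc (-(c : ℝ)) c))
    (hflB : ∀ ρ : ℝ, β < ρ → ρ < ((c / (2 * m) : ℚ) : ℝ) →
      (f1'.1 = true ↔ (((PolyMP.panelCentre (c / (2 * m)) j : ℚ) : ℝ) + ρ) - W.L1 ∈ Icc (-(c : ℝ)) c) ∧
      (f1'.2 = true ↔ (((PolyMP.panelCentre (c / (2 * m)) j : ℚ) : ℝ) + ρ) + W.L1 ∈ Icc (-(c : ℝ)) c) ∧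
      (f2'.1 = true ↔ (((PolyMP.panelCentre (c / (2 * m)) j : ℚ) : ℝ) + ρ) - W.L2 ∈ Icc (-(c : ℝ)) c) ∧
      (f2'.2 = true ↔ (((PolyMP.panelCentre (c / (2 * m)) j : ℚ) : ℝ) + ρ) + W.L2 ∈ Icc (-(c : ℝ)) c) ∧
      (f3'.1 = true ↔ (((PolyMP.panelCentre (c / (2 * m)) j : ℚ) : ℝ) + ρ) - W.L3 ∈ Icc (-(c : ℝ)) c) ∧
      (f3'.2 = true ↔ (((PolyMP.panelCentre (c / (2 * m)) j : ℚ) : ℝ) + ρ) + W.L3 ∈ Icc (-(c : ℝ)) c) ∧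
      (f4'.1 = true ↔ (((PolyMP.panelCentre (c / (2 * m)) j : ℚ) : ℝ) + ρ) - W.L4 ∈ Icc (-(c : ℝ)) c) ∧
      (f4'.2 = true ↔ (((PolyMP.panelCentre (c / (2 * m)) j : ℚ) : ℝ) + ρ) + W.L4 ∈ Icc (-(c : ℝ)) c))
    {Etm F N R : IPoly}
    (hE : dt_archETM S c m j Dl (dt_locI S (gp i) (ofRat S (PolyMP.panelCentre (c / (2 * m)) j))) W.M0 (ttruncI S (c / (2 * m)) Dl (dt_locI S (gp i) (ofRat S (PolyMP.panelCentre (c / (2 * m)) j)))) V.tabF W.muF (fun i ↦ (W.Dρ.getD i default).1) (fun i ↦ (W.Dρ.getD i default).2) = Etm)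
    (hF : dt_archHfoldTM S m j (ttruncI S (c / (2 * m)) Dl (dt_locI S (gp i) (ofRat S (PolyMP.panelCentre (c / (2 * m)) j)))) V.tabF W.muF = F) (hN : dt_archHnearTM S c m j Dl (ttruncI S (c / (2 * m)) Dl (dt_locI S (gp i) (ofRat S (PolyMP.panelCentre (c / (2 * m)) j)))) V.tabF W.muF (fun i ↦ (W.Dρ.getD i default).1) (fun i ↦ (W.Dρ.getD i default).2) = N)
    (hR : dt_archHfarTM S c m j Dl (ttruncI S (c / (2 * m)) Dl (dt_locI S (gp i) (ofRat S (PolyMP.panelCentre (c / (2 * m)) j)))) V.tabF W.muF (fun i ↦ (W.Dρ.getD i default).1) (fun i ↦ (W.Dρ.getD i default).2) = R)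
    {Etm' F' N' R' : IPoly}
    (hE' : dt_archETM S c m j Dl (dt_locI S (gp i') (ofRat S (PolyMP.panelCentre (c / (2 * m)) j))) W.M0 (ttruncI S (c / (2 * m)) Dl (dt_locI S (gp i') (ofRat S (PolyMP.panelCentre (c / (2 * m)) j)))) V'.tabF W.muF (fun i ↦ (W.Dρ.getD i default).1) (fun i ↦ (W.Dρ.getD i default).2) = Etm')
    (hF' : dt_archHfoldTM S m j (ttruncI S (c / (2 * m)) Dl (dt_locI S (gp i') (ofRat S (PolyMP.panelCentre (c / (2 * m)) j)))) V'.tabF W.muF = F') (hN' : dt_archHnearTM S c m j Dl (ttruncI S (c / (2 * m)) Dl (dt_locI S (gp i') (ofRat S (PolyMP.panelCentre (c / (2 * m)) j)))) V'.tabF W.muF (fun i ↦ (W.Dρ.getD i default).1) (fun i ↦ (W.Dρ.getD i default).2) = N')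
    (hR' : dt_archHfarTM S c m j Dl (ttruncI S (c / (2 * m)) Dl (dt_locI S (gp i') (ofRat S (PolyMP.panelCentre (c / (2 * m)) j)))) V'.tabF W.muF (fun i ↦ (W.Dρ.getD i default).1) (fun i ↦ (W.Dρ.getD i default).2) = R')
    (hfg : IntervalIntegrable (fun ρ ↦
      dt_windowResidual4 (c : ℝ) gp W.w1 W.L1 W.w2 W.L2 W.w3 W.L3 W.w4 W.L4 (Mt : ℝ) (fun a l ↦ (Wt a l : ℝ)) i
        (((PolyMP.panelCentre (c / (2 * m)) j : ℚ) : ℝ) + ρ) *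
      dt_windowResidual4 (c : ℝ) gp W.w1 W.L1 W.w2 W.L2 W.w3 W.L3 W.w4 W.L4 (Mt : ℝ) (fun a l ↦ (Wt a l : ℝ)) i'
        (((PolyMP.panelCentre (c / (2 * m)) j : ℚ) : ℝ) + ρ)) volume (-((c / (2 * m) : ℚ) : ℝ)) ((c / (2 * m) : ℚ) : ℝ))
    (pA pA' pB pB' : Poly) {dA dA' dB dB' : ℚ}
    (hdA : dt_tmRadQ S (c / (2 * m)) (dt_panelLTM4' S c m Dl K Ke ke W gp Mt Wt i V j f1 f2 f3 f4 Etm (taddI (tsubI F N) R)) pA ≤ dA)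
    (hdA' : dt_tmRadQ S (c / (2 * m)) (dt_panelLTM4' S c m Dl K Ke ke W gp Mt Wt i' V' j f1 f2 f3 f4 Etm' (taddI (tsubI F' N') R')) pA' ≤ dA')
    (hdB : dt_tmRadQ S (c / (2 * m)) (dt_panelLTM4' S c m Dl K Ke ke W gp Mt Wt i V j f1' f2' f3' f4' Etm (taddI (tsubI F N) R)) pB ≤ dB)
    (hdB' : dt_tmRadQ S (c / (2 * m)) (dt_panelLTM4' S c m Dl K Ke ke W gp Mt Wt i' V' j f1' f2' f3' f4' Etm' (taddI (tsubI F' N') R')) pB' ≤ dB') :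
    |(∫ ρ in (-((c / (2 * m) : ℚ) : ℝ))..((c / (2 * m) : ℚ) : ℝ),
        dt_windowResidual4 (c : ℝ) gp W.w1 W.L1 W.w2 W.L2 W.w3 W.L3 W.w4 W.L4 (Mt : ℝ) (fun a l ↦ (Wt a l : ℝ)) i
        (((PolyMP.panelCentre (c / (2 * m)) j : ℚ) : ℝ) + ρ) *
        dt_windowResidual4 (c : ℝ) gp W.w1 W.L1 W.w2 W.L2 W.w3 W.L3 W.w4 W.L4 (Mt : ℝ) (fun a l ↦ (Wt a l : ℝ)) i'
        (((PolyMP.panelCentre (c / (2 * m)) j : ℚ) : ℝ) + ρ)) -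
        (((crossCentreQ pA pA' (-(c / (2 * m))) bp : ℚ) : ℝ) + ((crossCentreQ pB pB' bm (c / (2 * m)) : ℚ) : ℝ))| ≤
      ((dt_crossErrRadQ dA dA' pA pA' (-(c / (2 * m))) bp (bp - bm) : ℚ) : ℝ) +
        ((dt_crossErrRadQ dB dB' pB pB' bm (c / (2 * m)) (bp - bm) : ℚ) : ℝ) := by
  have h1 := dt_panelCross4_split'' hS hc W hh1 gp Mt Wt i i' V V' hjm hK f1 f2 f3 f4 f1' f2' f3' f4' hchk hchk' hbmβ hβbp
    hflA hflB hE hF hN hR hE' hF' hN' hR' hfg pA pA' pB pB'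
  -- nonnegativity of the four true radii: every chunked model encloses the panel form of its residual
  have hck := hchk
  have hck' := hchk'
  unfold dt_splitCheckL at hck hck'
  simp only [Bool.and_eq_true, decide_eq_true_eq] at hck hck'
  obtain ⟨⟨⟨⟨he1, he2⟩, hbm⟩, hbp⟩, hlenM⟩ := hck
  obtain ⟨⟨⟨⟨_, _⟩, _⟩, _⟩, hlenM'⟩ := hck'
  have nA := dt_tmRadQ_panelLTM4'_nonneg hS hc W hh1 gp Mt Wt i V hjm hK f1 f2 f3 f4 he1 he2 hlenM hE hF hN hR pA
  have nB := dt_tmRadQ_panelLTM4'_nonneg hS hc W hh1 gp Mt Wt i V hjm hK f1' f2' f3' f4' he1 he2 hlenM hE hF hN hR pB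
  have nA' := dt_tmRadQ_panelLTM4'_nonneg hS hc W hh1 gp Mt Wt i' V' hjm hK f1 f2 f3 f4 he1 he2 hlenM' hE' hF' hN' hR' pA'
  have nB' := dt_tmRadQ_panelLTM4'_nonneg hS hc W hh1 gp Mt Wt i' V' hjm hK f1' f2' f3' f4' he1 he2 hlenM' hE' hF' hN' hR' pB'
  have hbmbp : bm ≤ bp := by exact_mod_cast hbmβ.trans hβbp
  have h2 := dt_crossErrQ_le_rad (a := -(c / (2 * m))) (b := bp) (w := bp - bm) (by linarith) nA nA' hdA hdA'
  have h3 := dt_crossErrQ_le_rad (a := bm) (b := c / (2 * m)) (w := bp - bm) (by linarith) nB nB' hdB hdB'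
  exact h1.trans (add_le_add ((Rat.cast_le (K := ℝ)).2 h2) ((Rat.cast_le (K := ℝ)).2 h3))

end CrossPanelsRad

end Summit.RiemannHypothesis.RiemannHypothesis.Theorems.EvenWinsBeyondArch
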